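import Summits.Ventures.CertifiedManyBodySolver.Downfold.EmeryOrbitalWeightAxis
import Summits.Ventures.CertifiedManyBodySolver.Downfold.EmeryFermiEnergyExistsAll
import HarnessLib

/-!
# The UNIVERSAL Fermi-surface Cu-d weight ceiling over a typed box — the axis weight `w_axis = t_pd²(Δ + ε)/(t_pd²(Δ + 2ε) − t_pp′ε²)`, its four one-line levers and
# the one-corner rule (INFL-3to1-B §B.90 (c): the U-leg ceiling at ANY filling, hole-like or electron-like Fermi surface alike)

Venture CertifiedManyBodySolver, cell `pub/hubbard-downfold` (stage S1; INFLATION-RULES-3to1-B §B.73 (g) (`EmeryOrbitalWeightAxis`: `w_node ≤ w_d(k) ≤ w_axis` at every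
zone point of every contour), §B.90 (this file)), seat hubbard-downfold-mod-4 (technique B, g38); namespace `Summit.Ventures.CertifiedManyBodySolver.Downfold.Emery`.
Everything PROVED (0 sorry; one-line cross-multiplication identities). Companion of `EmeryOrbitalWeightFaceBox` (the sharp antinodal window needs a hole-like Fermi
surface and the antinodal charge-transfer regime `4(t_pp + t_pp′) ≤ Δ + ε`; this ceiling needs neither — it serves fillings beyond the van Hove window of a box and
boxes outside the regime, at the price of the gap `w_axis − w_face` (≈ 0.01–0.04 on La₂CuO₄-type rows, ≈ 0.1 on large-t_pp rows)).
WHAT THIS IS NOT: a statement about any material; `U = 0` one-body kinematics of the σ model.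

* §1 `dWeightAxisCF Δ a c ε = a²(Δ + ε)/(a²(Δ + 2ε) − cε²)` and `dWeightAxis = dWeightAxisCF` (`EmeryOrbitalWeightAxis.dWeightAxis_eq`).
* §2 LEVERS at fixed energy: **`Δ ↑`** (`CF(Δ′)·D − CF(Δ)… = a²ε(Δ′ − Δ)(a² − cε) ≥ 0`), **`t_pd ↓`** (`(Δ + ε)cε²(a² − a′²) ≤ 0`), **`t_pp′ ↑`** (denominator), no `t_pp` dependence;
  energy lever `ε ↓` under the margin `c(Δ(ε₁ + ε₂) + ε₁ε₂) ≤ a²Δ` (`EmeryOrbitalWeightAxis.dWeightAxis_sub`).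
* §3 THE ONE-CORNER RULE (§4: the same with the two-energy margin `c₂(Δ₁(E_l + E_h) + E_lE_h) ≤ a₁²Δ₁`, `c₂(E_l + E_h) ≤ a₁²` for large-t_pp′ boxes): for every member of `[Δ₁, Δ₂] × [a₁, a₂] × [b₁, b₂] × [c₁, c₂]` at filling `ν` and EVERY zone Fermi point `(x, y)` of its Fermi surface:
  **`w_d(x, y; ε_F) ≤ dWeightAxisCF(Δ₂, a₁, c₂; E_l)`**, `E_l ≤ ε_F(Δ₂, a₁, b₁, c₂; ν)` the box's bottom Fermi energy, under `c₂E_h < a₁²` and the margin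
  `c₂(2ΔE_h + E_h²) ≤ a₁²Δ` at `Δ = Δ₁` (`E_h ≥ ε_F(Δ₁, a₂, b₂, c₁; ν)` the top Fermi energy).

Sources: three-band model [HybertsenSchluterChristensen1989, Eq. (1)]; two-level axis decoupling [AndersenEtAl1995, §6]; [folklore] algebra.
-/

noncomputable section

namespace Summit.Ventures.CertifiedManyBodySolver.Downfold.Emery

open Real Set

/-! ## §1 The closed form -/

/-- `dWeightAxisCF Δ a c ε = a²(Δ + ε)/(a²(Δ + 2ε) − cε²)`. [folklore] -/
def dWeightAxisCF (Δ a c ε : ℝ) : ℝ := a ^ 2 * (Δ + ε) / (a ^ 2 * (Δ + 2 * ε) - c * ε ^ 2)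

/-- The denominator is positive: `a²(Δ + 2ε) − cε² = a²Δ + ε(2a² − cε) > 0` for `Δ > 0`, `ε ≥ 0`, `0 ≤ c`, `cε < a²`. [folklore] -/
theorem dWeightAxisCF_den_pos {Δ a c ε : ℝ} (hΔ : 0 < Δ) (hε : 0 ≤ ε) (hc : 0 ≤ c) (hm : c * ε < a ^ 2) :
    0 < a ^ 2 * (Δ + 2 * ε) - c * ε ^ 2 := by
  have ha : 0 < a ^ 2 := lt_of_le_of_lt (mul_nonneg hc hε) hm
  have e : a ^ 2 * (Δ + 2 * ε) - c * ε ^ 2 = a ^ 2 * Δ + ε * (2 * a ^ 2 - c * ε) := by ring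
  rw [e]
  have : 0 ≤ ε * (2 * a ^ 2 - c * ε) := mul_nonneg hε (by linarith)
  positivity

/-- `dWeightAxis = dWeightAxisCF` (`Δ + ε > 0`, `ε > 0`, `a ≠ 0`, `cε < a²`). [folklore] -/
theorem dWeightAxis_eq_CF {Δ a b c ε : ℝ} (hE : 0 < Δ + ε) (hε : 0 < ε) (ha : a ≠ 0) (hm : c * ε < a ^ 2) :
    dWeightAxis Δ a b c ε = dWeightAxisCF Δ a c ε := by
  unfold dWeightAxisCF; exact dWeightAxis_eq hE hε ha hm

/-! ## §2 The levers -/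

/-- **Δ-lever**: `Δ ≤ Δ′` ⇒ `CF(Δ) ≤ CF(Δ′)` (`Δ > 0`, `ε ≥ 0`, `cε < a²`, `c ≥ 0`). [folklore] -/
theorem dWeightAxisCF_mono_Delta {Δ Δ' a c ε : ℝ} (hΔ : 0 < Δ) (hΔΔ : Δ ≤ Δ') (hε : 0 ≤ ε) (hc : 0 ≤ c) (hm : c * ε < a ^ 2) :
    dWeightAxisCF Δ a c ε ≤ dWeightAxisCF Δ' a c ε := by
  have hD := dWeightAxisCF_den_pos hΔ hε hc hm
  have hD' := dWeightAxisCF_den_pos (lt_of_lt_of_le hΔ hΔΔ) hε hc hm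
  unfold dWeightAxisCF
  rw [div_le_div_iff₀ hD hD']
  have key : a ^ 2 * (Δ' + ε) * (a ^ 2 * (Δ + 2 * ε) - c * ε ^ 2) - a ^ 2 * (Δ + ε) * (a ^ 2 * (Δ' + 2 * ε) - c * ε ^ 2) =
      a ^ 2 * ε * (Δ' - Δ) * (a ^ 2 - c * ε) := by ring
  have hnn : 0 ≤ a ^ 2 * ε * (Δ' - Δ) * (a ^ 2 - c * ε) := by
    have : 0 ≤ Δ' - Δ := by linarith
    have : 0 ≤ a ^ 2 - c * ε := by linarith
    positivity
  linarith

/-- **t_pd-lever**: `0 < a ≤ a′` ⇒ `CF(a′) ≤ CF(a)` — the axis weight DECREASES with the hybridisation (the oxygen admixture `cε²` weighs less against a larger `a²`…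
at fixed energy the opposite: `CF = (Δ + ε)/((Δ + 2ε) − cε²/a²)` decreases as `cε²/a²` shrinks) (`Δ > 0`, `ε ≥ 0`, `c ≥ 0`, `cε < a²`). [folklore] -/
theorem dWeightAxisCF_anti_tpd {Δ a a' c ε : ℝ} (hΔ : 0 < Δ) (ha : 0 < a) (haa : a ≤ a') (hε : 0 ≤ ε) (hc : 0 ≤ c) (hm : c * ε < a ^ 2) :
    dWeightAxisCF Δ a' c ε ≤ dWeightAxisCF Δ a c ε := by
  have haa2 : a ^ 2 ≤ a' ^ 2 := by nlinarith
  have hm' : c * ε < a' ^ 2 := lt_of_lt_of_le hm haa2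
  have hD := dWeightAxisCF_den_pos hΔ hε hc hm
  have hD' := dWeightAxisCF_den_pos hΔ hε hc hm'
  unfold dWeightAxisCF
  rw [div_le_div_iff₀ hD' hD]
  have key : a ^ 2 * (Δ + ε) * (a' ^ 2 * (Δ + 2 * ε) - c * ε ^ 2) - a' ^ 2 * (Δ + ε) * (a ^ 2 * (Δ + 2 * ε) - c * ε ^ 2) =
      (Δ + ε) * (c * ε ^ 2) * (a' ^ 2 - a ^ 2) := by ring
  have hnn : 0 ≤ (Δ + ε) * (c * ε ^ 2) * (a' ^ 2 - a ^ 2) := by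
    have : 0 ≤ a' ^ 2 - a ^ 2 := by linarith
    have : 0 ≤ Δ + ε := by linarith
    positivity
  linarith

/-- **t_pp′-lever**: `c ≤ c′` (`c′ε < a²`) ⇒ `CF(c) ≤ CF(c′)`. [folklore] -/
theorem dWeightAxisCF_mono_tppP {Δ a c c' ε : ℝ} (hΔ : 0 < Δ) (hε : 0 ≤ ε) (hc : 0 ≤ c) (hcc : c ≤ c') (hm : c' * ε < a ^ 2) :
    dWeightAxisCF Δ a c ε ≤ dWeightAxisCF Δ a c' ε := by
  have hm0 : c * ε < a ^ 2 := lt_of_le_of_lt (mul_le_mul_of_nonneg_right hcc hε) hm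
  have hD := dWeightAxisCF_den_pos hΔ hε hc hm0
  have hD' := dWeightAxisCF_den_pos hΔ hε (hc.trans hcc) hm
  have hN : 0 ≤ a ^ 2 * (Δ + ε) := by have : 0 ≤ Δ + ε := by linarith
                                      positivity
  unfold dWeightAxisCF
  exact div_le_div_of_nonneg_left hN hD' (by nlinarith [mul_le_mul_of_nonneg_right hcc (sq_nonneg ε)])

/-- **energy lever** (non-strict form of `dWeightAxis_strictAnti` on the closed form): `0 ≤ ε₁ ≤ ε₂`, `cε₂ < a²`, `c(Δ(ε₁ + ε₂) + ε₁ε₂) ≤ a²Δ` ⇒ `CF(ε₂) ≤ CF(ε₁)`.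
[folklore] -/
theorem dWeightAxisCF_anti_eps {Δ a c ε₁ ε₂ : ℝ} (hΔ : 0 < Δ) (hc : 0 ≤ c) (h1 : 0 ≤ ε₁) (h12 : ε₁ ≤ ε₂) (hm : c * ε₂ < a ^ 2)
    (hlev : c * (Δ * (ε₁ + ε₂) + ε₁ * ε₂) ≤ a ^ 2 * Δ) : dWeightAxisCF Δ a c ε₂ ≤ dWeightAxisCF Δ a c ε₁ := by
  have h2 : 0 ≤ ε₂ := h1.trans h12
  have hm1 : c * ε₁ < a ^ 2 := lt_of_le_of_lt (mul_le_mul_of_nonneg_left h12 hc) hm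
  have hD1 := dWeightAxisCF_den_pos hΔ h1 hc hm1
  have hD2 := dWeightAxisCF_den_pos hΔ h2 hc hm
  unfold dWeightAxisCF
  rw [div_le_div_iff₀ hD2 hD1]
  have key : a ^ 2 * (Δ + ε₁) * (a ^ 2 * (Δ + 2 * ε₂) - c * ε₂ ^ 2) - a ^ 2 * (Δ + ε₂) * (a ^ 2 * (Δ + 2 * ε₁) - c * ε₁ ^ 2) =
      a ^ 2 * (ε₂ - ε₁) * (a ^ 2 * Δ - c * (Δ * (ε₁ + ε₂) + ε₁ * ε₂)) := by ring
  have hnn : 0 ≤ a ^ 2 * (ε₂ - ε₁) * (a ^ 2 * Δ - c * (Δ * (ε₁ + ε₂) + ε₁ * ε₂)) := by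
    have : 0 ≤ ε₂ - ε₁ := by linarith
    have : 0 ≤ a ^ 2 * Δ - c * (Δ * (ε₁ + ε₂) + ε₁ * ε₂) := by linarith
    positivity
  linarith

/-! ## §3 The one-corner rule over a typed box -/

/-- **THE UNIVERSAL Cu-d WEIGHT CEILING OVER A TYPED BOX.** For every member `θ = (Δ, a, b, c)` of `[Δ₁, Δ₂] × [a₁, a₂] × [b₁, b₂] × [c₁, c₂]` (`Δ₁ > 0`, `a₁ > 0`,
`0 ≤ c₁`, `c₂ ≤ b₁`, `0 < b₁`) at filling `0 < ν < 1`, with `0 < E_l ≤ ε_F(Δ₂, a₁, b₁, c₂; ν)`, `ε_F(Δ₁, a₂, b₂, c₁; ν) ≤ E_h`, `c₂E_h < a₁²` and the energy-lever margin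
`c₂(2Δ₁E_h + E_h²) ≤ a₁²Δ₁`: **every zone point `(x, y)` of the member's Fermi surface has `w_d(x, y; ε_F) ≤ dWeightAxisCF(Δ₂, a₁, c₂; E_l)`** — whatever the topology
of the Fermi surface. [folklore] -/
theorem dWeight_le_axisCF_of_mem_box {Δ a b c Δ₁ Δ₂ a₁ a₂ b₁ b₂ c₁ c₂ ν El Eh x y : ℝ} (hΔ₁ : 0 < Δ₁) (ha₁ : 0 < a₁) (hc₁ : 0 ≤ c₁) (hcb : c₂ ≤ b₁)
    (hb₁ : 0 < b₁) (hΔ : Δ ∈ Icc Δ₁ Δ₂) (ha : a ∈ Icc a₁ a₂) (hb : b ∈ Icc b₁ b₂) (hc : c ∈ Icc c₁ c₂) (hν0 : 0 < ν) (hν1 : ν < 1)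
    (hEl0 : 0 < El) (hEl : El ≤ fermiEnergyOf Δ₂ a₁ b₁ c₂ ν) (hEh : fermiEnergyOf Δ₁ a₂ b₂ c₁ ν ≤ Eh) (hm : c₂ * Eh < a₁ ^ 2)
    (hlev : c₂ * (2 * Δ₁ * Eh + Eh ^ 2) ≤ a₁ ^ 2 * Δ₁)
    (hx : x ∈ Icc (0 : ℝ) 1) (hy : y ∈ Icc (0 : ℝ) 1) (hP : charCubic Δ a b c x y (fermiEnergyOf Δ a b c ν) = 0) :
    dWeight Δ a b c x y (fermiEnergyOf Δ a b c ν) ≤ dWeightAxisCF Δ₂ a₁ c₂ El := by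
  have hΔ0 : 0 < Δ := lt_of_lt_of_le hΔ₁ hΔ.1
  have ha0 : 0 < a := lt_of_lt_of_le ha₁ ha.1
  have hc0 : 0 ≤ c := hc₁.trans hc.1
  have hb0 : 0 < b := lt_of_lt_of_le hb₁ hb.1
  have hcb' : c ≤ b := (hc.2.trans hcb).trans hb.1
  have hc₂ : 0 ≤ c₂ := hc0.trans hc.2
  have hbox := fermiEnergyOf_mem_Icc_of_mem_box' hΔ₁ ha₁ hb₁.le hc₁ hΔ ha hb hc hν0 hν1
  set E := fermiEnergyOf Δ a b c ν with hE
  have hEl' : El ≤ E := hEl.trans hbox.1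
  have hEh' : E ≤ Eh := hbox.2.trans hEh
  have hE0 : 0 < E := lt_of_lt_of_le hEl0 hEl'
  have hEh0 : 0 ≤ Eh := hE0.le.trans hEh'
  have haa : a₁ ^ 2 ≤ a ^ 2 := by nlinarith [ha.1]
  have hmE : c * E < a ^ 2 := by
    calc c * E ≤ c₂ * Eh := mul_le_mul hc.2 hEh' hE0.le hc₂
      _ < a₁ ^ 2 := hm
      _ ≤ a ^ 2 := haa
  -- (1) universal bound at the member's own energy
  have h1 := (dWeight_mem_Icc_node_axis hΔ0.le hc0 hcb' hb0 ha0.ne' hE0 hmE hx hy hP).2.2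
  -- (2) closed form, energy lever down to El
  rw [dWeightAxis_eq_CF (by linarith) hE0 ha0.ne' hmE] at h1
  have h2 : dWeightAxisCF Δ a c E ≤ dWeightAxisCF Δ a c El := by
    refine dWeightAxisCF_anti_eps hΔ0 hc0 hEl0.le hEl' hmE ?_
    have hlev' : c * (Δ * (El + E) + El * E) ≤ c₂ * (2 * Δ * Eh + Eh ^ 2) := by
      have hin : Δ * (El + E) + El * E ≤ 2 * Δ * Eh + Eh ^ 2 := by nlinarith [hEl0.le, hE0.le]
      calc c * (Δ * (El + E) + El * E) ≤ c * (2 * Δ * Eh + Eh ^ 2) := mul_le_mul_of_nonneg_left hin hc0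
        _ ≤ c₂ * (2 * Δ * Eh + Eh ^ 2) := mul_le_mul_of_nonneg_right hc.2 (by positivity)
    -- c₂(2ΔE_h + E_h²) ≤ a₁²Δ for Δ ≥ Δ₁: from the hypothesis at Δ₁ (the slack a₁² − 2c₂E_h ≥ 0 grows the right side faster)
    have hslack : 0 ≤ a₁ ^ 2 - 2 * c₂ * Eh := by nlinarith [sq_nonneg Eh, hΔ₁]
    have hΔm : c₂ * (2 * Δ * Eh + Eh ^ 2) ≤ a₁ ^ 2 * Δ := by nlinarith [hΔ.1]
    nlinarith [mul_le_mul_of_nonneg_right haa hΔ0.le]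
  -- (3) coordinate levers at El: Δ → Δ₂, a → a₁, c → c₂
  have hmEl : c * El < a ^ 2 := lt_of_le_of_lt (mul_le_mul_of_nonneg_left hEl' hc0) hmE
  have hmEl₁ : c₂ * El < a₁ ^ 2 := lt_of_le_of_lt (mul_le_mul_of_nonneg_left (hEl'.trans hEh') hc₂) hm
  have h3 : dWeightAxisCF Δ a c El ≤ dWeightAxisCF Δ₂ a₁ c₂ El :=
    calc dWeightAxisCF Δ a c El ≤ dWeightAxisCF Δ₂ a c El := dWeightAxisCF_mono_Delta hΔ0 hΔ.2 hEl0.le hc0 hmEl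
      _ ≤ dWeightAxisCF Δ₂ a₁ c El :=
          dWeightAxisCF_anti_tpd (lt_of_lt_of_le hΔ0 hΔ.2) ha₁ ha.1 hEl0.le hc0 (lt_of_le_of_lt (mul_le_mul_of_nonneg_left (hEl'.trans hEh') hc0) (lt_of_le_of_lt (mul_le_mul_of_nonneg_right hc.2 hEh0) hm))
      _ ≤ dWeightAxisCF Δ₂ a₁ c₂ El := dWeightAxisCF_mono_tppP (lt_of_lt_of_le hΔ0 hΔ.2) hEl0.le hc0 hc.2 hmEl₁
  exact h1.trans (h2.trans h3)

/-- **Numeric form**: with `dWeightAxisCF(Δ₂, a₁, c₂; E_l) ≤ hi` checked by `norm_num`, every Fermi-surface Bloch state of every member has Cu-d weight `≤ hi`. [folklore] -/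
theorem dWeight_le_of_mem_box_axis {Δ a b c Δ₁ Δ₂ a₁ a₂ b₁ b₂ c₁ c₂ ν El Eh x y hi : ℝ} (hΔ₁ : 0 < Δ₁) (ha₁ : 0 < a₁) (hc₁ : 0 ≤ c₁) (hcb : c₂ ≤ b₁)
    (hb₁ : 0 < b₁) (hΔ : Δ ∈ Icc Δ₁ Δ₂) (ha : a ∈ Icc a₁ a₂) (hb : b ∈ Icc b₁ b₂) (hc : c ∈ Icc c₁ c₂) (hν0 : 0 < ν) (hν1 : ν < 1)
    (hEl0 : 0 < El) (hEl : El ≤ fermiEnergyOf Δ₂ a₁ b₁ c₂ ν) (hEh : fermiEnergyOf Δ₁ a₂ b₂ c₁ ν ≤ Eh) (hm : c₂ * Eh < a₁ ^ 2)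
    (hlev : c₂ * (2 * Δ₁ * Eh + Eh ^ 2) ≤ a₁ ^ 2 * Δ₁) (hhi : dWeightAxisCF Δ₂ a₁ c₂ El ≤ hi)
    (hx : x ∈ Icc (0 : ℝ) 1) (hy : y ∈ Icc (0 : ℝ) 1) (hP : charCubic Δ a b c x y (fermiEnergyOf Δ a b c ν) = 0) :
    dWeight Δ a b c x y (fermiEnergyOf Δ a b c ν) ≤ hi :=
  (dWeight_le_axisCF_of_mem_box hΔ₁ ha₁ hc₁ hcb hb₁ hΔ ha hb hc hν0 hν1 hEl0 hEl hEh hm hlev hx hy hP).trans hhi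

/-! ## §4 The one-corner rule with the two-energy margin (large-t_pp′ boxes) -/

/-- **THE UNIVERSAL CEILING WITH THE FINER ENERGY-LEVER MARGIN**: as `dWeight_le_axisCF_of_mem_box`, but the margin is read with BOTH box energies —
`c₂(Δ₁(E_l + E_h) + E_lE_h) ≤ a₁²Δ₁` and `c₂(E_l + E_h) ≤ a₁²` (so that it holds for every `Δ ≥ Δ₁`) — instead of `c₂(2Δ₁E_h + E_h²) ≤ a₁²Δ₁`. [folklore] -/
theorem dWeight_le_axisCF_of_mem_box' {Δ a b c Δ₁ Δ₂ a₁ a₂ b₁ b₂ c₁ c₂ ν El Eh x y : ℝ} (hΔ₁ : 0 < Δ₁) (ha₁ : 0 < a₁) (hc₁ : 0 ≤ c₁) (hcb : c₂ ≤ b₁)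
    (hb₁ : 0 < b₁) (hΔ : Δ ∈ Icc Δ₁ Δ₂) (ha : a ∈ Icc a₁ a₂) (hb : b ∈ Icc b₁ b₂) (hc : c ∈ Icc c₁ c₂) (hν0 : 0 < ν) (hν1 : ν < 1)
    (hEl0 : 0 < El) (hEl : El ≤ fermiEnergyOf Δ₂ a₁ b₁ c₂ ν) (hEh : fermiEnergyOf Δ₁ a₂ b₂ c₁ ν ≤ Eh) (hm : c₂ * Eh < a₁ ^ 2)
    (hlev : c₂ * (Δ₁ * (El + Eh) + El * Eh) ≤ a₁ ^ 2 * Δ₁) (hslope : c₂ * (El + Eh) ≤ a₁ ^ 2)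
    (hx : x ∈ Icc (0 : ℝ) 1) (hy : y ∈ Icc (0 : ℝ) 1) (hP : charCubic Δ a b c x y (fermiEnergyOf Δ a b c ν) = 0) :
    dWeight Δ a b c x y (fermiEnergyOf Δ a b c ν) ≤ dWeightAxisCF Δ₂ a₁ c₂ El := by
  have hΔ0 : 0 < Δ := lt_of_lt_of_le hΔ₁ hΔ.1
  have ha0 : 0 < a := lt_of_lt_of_le ha₁ ha.1
  have hc0 : 0 ≤ c := hc₁.trans hc.1
  have hb0 : 0 < b := lt_of_lt_of_le hb₁ hb.1
  have hcb' : c ≤ b := (hc.2.trans hcb).trans hb.1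
  have hc₂ : 0 ≤ c₂ := hc0.trans hc.2
  have hbox := fermiEnergyOf_mem_Icc_of_mem_box' hΔ₁ ha₁ hb₁.le hc₁ hΔ ha hb hc hν0 hν1
  set E := fermiEnergyOf Δ a b c ν with hE
  have hEl' : El ≤ E := hEl.trans hbox.1
  have hEh' : E ≤ Eh := hbox.2.trans hEh
  have hE0 : 0 < E := lt_of_lt_of_le hEl0 hEl'
  have hEh0 : 0 ≤ Eh := hE0.le.trans hEh'
  have haa : a₁ ^ 2 ≤ a ^ 2 := by nlinarith [ha.1]
  have hmE : c * E < a ^ 2 := by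
    calc c * E ≤ c₂ * Eh := mul_le_mul hc.2 hEh' hE0.le hc₂
      _ < a₁ ^ 2 := hm
      _ ≤ a ^ 2 := haa
  have h1 := (dWeight_mem_Icc_node_axis hΔ0.le hc0 hcb' hb0 ha0.ne' hE0 hmE hx hy hP).2.2
  rw [dWeightAxis_eq_CF (by linarith) hE0 ha0.ne' hmE] at h1
  have h2 : dWeightAxisCF Δ a c E ≤ dWeightAxisCF Δ a c El := by
    refine dWeightAxisCF_anti_eps hΔ0 hc0 hEl0.le hEl' hmE ?_
    have hin : Δ * (El + E) + El * E ≤ Δ * (El + Eh) + El * Eh := by nlinarith [hEl0.le, hΔ0.le]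
    have hup : c * (Δ * (El + E) + El * E) ≤ c₂ * (Δ * (El + Eh) + El * Eh) :=
      calc c * (Δ * (El + E) + El * E) ≤ c * (Δ * (El + Eh) + El * Eh) := mul_le_mul_of_nonneg_left hin hc0
        _ ≤ c₂ * (Δ * (El + Eh) + El * Eh) := mul_le_mul_of_nonneg_right hc.2 (by positivity)
    -- c₂(Δ(El + Eh) + El·Eh) ≤ a₁²Δ for Δ ≥ Δ₁ (value at Δ₁ + slope)
    have hΔm : c₂ * (Δ * (El + Eh) + El * Eh) ≤ a₁ ^ 2 * Δ := by nlinarith [hΔ.1]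
    nlinarith [mul_le_mul_of_nonneg_right haa hΔ0.le]
  have hmEl : c * El < a ^ 2 := lt_of_le_of_lt (mul_le_mul_of_nonneg_left hEl' hc0) hmE
  have hmEl₁ : c₂ * El < a₁ ^ 2 := lt_of_le_of_lt (mul_le_mul_of_nonneg_left (hEl'.trans hEh') hc₂) hm
  have h3 : dWeightAxisCF Δ a c El ≤ dWeightAxisCF Δ₂ a₁ c₂ El :=
    calc dWeightAxisCF Δ a c El ≤ dWeightAxisCF Δ₂ a c El := dWeightAxisCF_mono_Delta hΔ0 hΔ.2 hEl0.le hc0 hmEl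
      _ ≤ dWeightAxisCF Δ₂ a₁ c El :=
          dWeightAxisCF_anti_tpd (lt_of_lt_of_le hΔ0 hΔ.2) ha₁ ha.1 hEl0.le hc0 (lt_of_le_of_lt (mul_le_mul_of_nonneg_left (hEl'.trans hEh') hc0) (lt_of_le_of_lt (mul_le_mul_of_nonneg_right hc.2 hEh0) hm))
      _ ≤ dWeightAxisCF Δ₂ a₁ c₂ El := dWeightAxisCF_mono_tppP (lt_of_lt_of_le hΔ0 hΔ.2) hEl0.le hc0 hc.2 hmEl₁
  exact h1.trans (h2.trans h3)

/-- **Numeric form** of `dWeight_le_axisCF_of_mem_box'`. [folklore] -/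
theorem dWeight_le_of_mem_box_axis' {Δ a b c Δ₁ Δ₂ a₁ a₂ b₁ b₂ c₁ c₂ ν El Eh x y hi : ℝ} (hΔ₁ : 0 < Δ₁) (ha₁ : 0 < a₁) (hc₁ : 0 ≤ c₁) (hcb : c₂ ≤ b₁)
    (hb₁ : 0 < b₁) (hΔ : Δ ∈ Icc Δ₁ Δ₂) (ha : a ∈ Icc a₁ a₂) (hb : b ∈ Icc b₁ b₂) (hc : c ∈ Icc c₁ c₂) (hν0 : 0 < ν) (hν1 : ν < 1)
    (hEl0 : 0 < El) (hEl : El ≤ fermiEnergyOf Δ₂ a₁ b₁ c₂ ν) (hEh : fermiEnergyOf Δ₁ a₂ b₂ c₁ ν ≤ Eh) (hm : c₂ * Eh < a₁ ^ 2)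
    (hlev : c₂ * (Δ₁ * (El + Eh) + El * Eh) ≤ a₁ ^ 2 * Δ₁) (hslope : c₂ * (El + Eh) ≤ a₁ ^ 2) (hhi : dWeightAxisCF Δ₂ a₁ c₂ El ≤ hi)
    (hx : x ∈ Icc (0 : ℝ) 1) (hy : y ∈ Icc (0 : ℝ) 1) (hP : charCubic Δ a b c x y (fermiEnergyOf Δ a b c ν) = 0) :
    dWeight Δ a b c x y (fermiEnergyOf Δ a b c ν) ≤ hi :=
  (dWeight_le_axisCF_of_mem_box' hΔ₁ ha₁ hc₁ hcb hb₁ hΔ ha hb hc hν0 hν1 hEl0 hEl hEh hm hlev hslope hx hy hP).trans hhi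

end Summit.Ventures.CertifiedManyBodySolver.Downfold.Emery
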